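import Summits.QuantumFields.YangMills.Theorems.BalabanUVNodesN19ContinuumLawAtScheme
import Mathlib.Topology.ContinuousMap.StoneWeierstrass
import Mathlib.Topology.Algebra.MvPolynomial

/-!
# YM-DAG node N19 (= NE7 proper) — THE CONTINUUM JOINT LAWS: `HasContinuumLimit` ⇒ every finite-dimensional law of the string field converges

Cell `pub-ymgap`, HUMAN RULING D-0062 (Track A), R141 (C) wider-strategy seat `pub-ymgap-dag-n19-e` (strategy s3 = ALTERNATIVE CURRENCY), generation
g18, module 6.  Route `Summits/QuantumFields/YangMills/Theses/BalabanUVNodes.lean` rev 25, cluster item K3⁷ «SpineGivenEndpointR13SepCoPH»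
(stmt-QuantumFields-20544, dag-lead WORDS-143); filed `--supports` that item `--as helper` (it proves no registered stub).  COUNT-NEUTRAL: [folklore]
measure theory over Mathlib (multivariate Stone–Weierstrass `ContinuousMap.exists_mem_subalgebra_near_continuous_of_isCompact_of_separatesPoints` on the
range of `MvPolynomial.aeval` at the coordinate functions; Riesz–Markov–Kakutani `RealRMK.rieszMeasure` on the compact cube `ι → [−B,B]`) + the tree's
`Missing.HasContinuumLimit` ∕ `T4ApexVariance.hasContinuumLimit_of_stringwiseMatching` ∕ `T4GenFunBounds.expectAt_eq_integral_gibbs` BY NAME; the apex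
predicates enter as HYPOTHESES; no Theses import; NOT a discharge claim.

THE POINT.  g9's p504707 ∕ p505344 built the continuum LAW of ONE string observable `∏os ∈ [−1,1]` (from its moments, all of which are expectations of
strings).  The apex predicate `Missing.HasContinuumLimit S` — Jaffe–Witten's «existence of limits of appropriate expectations of gauge-invariant
observables» as the tree types it: `∀ os, ∃ l, S.expectAt K os → l` — says MORE at law level than string by string: since a product of string observables
is the observable of the concatenated string, ALL MIXED MOMENTS `E_K[∏_i (∏os_i)^{k_i}]` of any finite family `(∏os_i)_{i∈ι}` converge, hence (§1,
multivariate Weierstrass on the cube + Cauchy, then Riesz–Markov–Kakutani) the JOINT LAW of `(∏os_i)_i` under `gibbs_K` converges weakly to a unique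
probability law `ν_ι` on `[−1,1]^ι`.  ★★ `exists_jointContinuumLaw_of_hasContinuumLimit` (§2); under node U5's per-string output
`T4ApexVariance.StringwiseMatching S` via the tree's `hasContinuumLimit_of_stringwiseMatching` (★ `exists_jointContinuumLaw_of_stringwiseMatching`).
So the programme's endpoint, read at law level, is a consistent family of finite-dimensional continuum distributions of the Wilson-string field on the
FIXED torus — nothing more (no rate here: a multivariate Jackson theorem is not in the tree; for ONE string the rate is p556871's `log(e+L_K)∕(1+L_K)`).

HONEST FRAMING (binding).  [folklore]; NO consumer in the DAG today.  `HasContinuumLimit` ∕ `StringwiseMatching` are HYPOTHESES (the cell's located,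
unprinted estimates U1–U5 stand between Bałaban's papers and them); nothing of Bałaban's is instantiated; N19 NOT discharged; count-neutral.  One finite
`T⁴` programme at fixed `ε` → 0 at FIXED volume; nothing `ℝ⁴` ∕ infinite-volume ∕ OS ∕ mass-gap ∕ Clay.  0 `def` ∕ 0 `sorry`.
-/

noncomputable section

open Set Filter Topology MeasureTheory ProbabilityTheory
open scoped CompactlySupported

namespace Summit.QuantumFields.YangMills.Theorems.BalabanUVNodesN19ContinuumJointLaws

open Literature.MathematicalPhysics.QuantumFieldTheory.Balaban1983to89

/-! ## §1 Generic [folklore]: a uniformly bounded VECTOR observable all of whose mixed moments converge has a unique continuum joint law on the cube -/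

section Generic

variable {Ω : ℕ → Type*} [∀ K, MeasurableSpace (Ω K)] {μ : ∀ K, Measure (Ω K)}
  {ι : Type*} {X : ∀ K, ι → Ω K → ℝ} {B : ℝ}

/-- The vector observable `ω ↦ (X K i ω)_i` is a.e.-measurable. [folklore] -/
theorem aemeasurable_vec [Fintype ι] (hX : ∀ K i, AEMeasurable (X K i) (μ K)) (K : ℕ) :
    AEMeasurable (fun ω => fun i => X K i ω) (μ K) :=
  aemeasurable_pi_lambda _ fun i => hX K i

omit [∀ K, MeasurableSpace (Ω K)] in
/-- The vector observable takes values in the cube `[−B, B]^ι`. [folklore] -/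
theorem vec_mem_cube (hB : ∀ K i ω, |X K i ω| ≤ B) (K : ℕ) (ω : Ω K) :
    (fun i => X K i ω) ∈ Set.pi Set.univ (fun _ : ι => Icc (-B) B) :=
  Set.mem_univ_pi.2 fun i => abs_le.1 (hB K i ω)

/-- A continuous function of the vector observable is integrable (bounded on the compact cube). [folklore] -/
theorem integrable_comp_vec [∀ K, IsProbabilityMeasure (μ K)] [Fintype ι] (hX : ∀ K i, AEMeasurable (X K i) (μ K)) (hB : ∀ K i ω, |X K i ω| ≤ B)
    {f : (ι → ℝ) → ℝ} (hf : Continuous f) (K : ℕ) : Integrable (fun ω => f (fun i => X K i ω)) (μ K) := by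
  obtain ⟨C, hC⟩ := (isCompact_univ_pi fun _ : ι => (isCompact_Icc : IsCompact (Icc (-B) B))).exists_bound_of_continuousOn
    hf.continuousOn
  exact (integrable_const C).mono' (hf.comp_aestronglyMeasurable (aemeasurable_vec hX K).aestronglyMeasurable)
    (ae_of_all _ fun ω => hC _ (vec_mem_cube hB K ω))

/-- **POLYNOMIAL OBSERVABLES CONVERGE**: if every mixed moment `∫ ∏_i (X K i)^{k_i} dμ_K` converges, so does `∫ p(X K) dμ_K` for every real
polynomial `p` in `ι` variables (induction on `p`, carrying a monomial multiplier). [folklore] -/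
theorem tendsto_integral_mvPolynomial_of_tendsto_mixedMoments [∀ K, IsProbabilityMeasure (μ K)] [Fintype ι] [DecidableEq ι]
    (hX : ∀ K i, AEMeasurable (X K i) (μ K)) (hB : ∀ K i ω, |X K i ω| ≤ B)
    (hmom : ∀ k : ι → ℕ, ∃ a : ℝ, Tendsto (fun K => ∫ ω, ∏ i, X K i ω ^ k i ∂μ K) atTop (𝓝 a))
    (p : MvPolynomial ι ℝ) :
    ∃ a : ℝ, Tendsto (fun K => ∫ ω, MvPolynomial.eval (fun i => X K i ω) p ∂μ K) atTop (𝓝 a) := by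
  -- strengthened statement: with an arbitrary monomial multiplier
  suffices h : ∀ k : ι → ℕ, ∃ a : ℝ,
      Tendsto (fun K => ∫ ω, MvPolynomial.eval (fun i => X K i ω) p * ∏ i, X K i ω ^ k i ∂μ K) atTop (𝓝 a) by
    obtain ⟨a, ha⟩ := h 0
    exact ⟨a, ha.congr fun K => by simp⟩
  induction p using MvPolynomial.induction_on with
  | C a =>
    intro k
    obtain ⟨b, hb⟩ := hmom k
    refine ⟨a * b, (hb.const_mul a).congr fun K => ?_⟩
    simp only [MvPolynomial.eval_C]
    exact (integral_const_mul a _).symm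
  | add p q hp hq =>
    intro k
    obtain ⟨a, ha⟩ := hp k
    obtain ⟨b, hb⟩ := hq k
    refine ⟨a + b, (ha.add hb).congr fun K => ?_⟩
    have hIp := integrable_comp_vec hX hB (f := fun v => MvPolynomial.eval v p * ∏ i, v i ^ k i)
      ((MvPolynomial.continuous_eval p).mul (by fun_prop)) K
    have hIq := integrable_comp_vec hX hB (f := fun v => MvPolynomial.eval v q * ∏ i, v i ^ k i)
      ((MvPolynomial.continuous_eval q).mul (by fun_prop)) K
    rw [← integral_add hIp hIq]
    refine integral_congr_ae (ae_of_all _ fun ω => ?_)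
    simp only [map_add]
    ring
  | mul_X p n hp =>
    intro k
    obtain ⟨a, ha⟩ := hp (Function.update k n (k n + 1))
    refine ⟨a, ha.congr fun K => integral_congr_ae (ae_of_all _ fun ω => ?_)⟩
    simp only [MvPolynomial.eval_X, map_mul]
    -- `∏ X^{k'} = X n · ∏ X^{k}`
    have h1 : ∏ i, X K i ω ^ Function.update k n (k n + 1) i = X K n ω * ∏ i, X K i ω ^ k i := by
      rw [← Finset.mul_prod_erase Finset.univ _ (Finset.mem_univ n), ← Finset.mul_prod_erase Finset.univ (fun i => X K i ω ^ k i)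
        (Finset.mem_univ n), Function.update_self, pow_succ]
      have h2 : ∏ i ∈ Finset.univ.erase n, X K i ω ^ Function.update k n (k n + 1) i = ∏ i ∈ Finset.univ.erase n, X K i ω ^ k i :=
        Finset.prod_congr rfl fun i hi => by rw [Function.update_of_ne (Finset.ne_of_mem_erase hi)]
      rw [h2]
      ring
    rw [h1]
    ring

/-- The coordinate subalgebra: the range of `MvPolynomial.aeval` at the coordinate functions of `C(ι → ℝ, ℝ)`; its elements evaluate as polynomials.
[folklore] -/
theorem aeval_coord_apply (p : MvPolynomial ι ℝ) (x : ι → ℝ) :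
    (MvPolynomial.aeval (fun i : ι => (⟨fun v : ι → ℝ => v i, continuous_apply i⟩ : C(ι → ℝ, ℝ))) p) x =
      MvPolynomial.eval x p := by
  induction p using MvPolynomial.induction_on with
  | C a => simp
  | add p q hp hq => simp [hp, hq]
  | mul_X p n hp => simp [hp]

/-- The coordinate subalgebra separates the points of `ι → ℝ`. [folklore] -/
theorem coordSubalgebra_separatesPoints :
    ((MvPolynomial.aeval (fun i : ι => (⟨fun v : ι → ℝ => v i, continuous_apply i⟩ : C(ι → ℝ, ℝ)))).range :
      Subalgebra ℝ C(ι → ℝ, ℝ)).SeparatesPoints := by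
  intro x y hxy
  obtain ⟨i, hi⟩ := Function.ne_iff.1 hxy
  refine ⟨fun v => v i, ⟨⟨fun v : ι → ℝ => v i, continuous_apply i⟩, ?_, rfl⟩, hi⟩
  exact ⟨MvPolynomial.X i, by simp⟩

/-- ★ **EVERY CONTINUOUS OBSERVABLE OF THE VECTOR `X_K` CONVERGES** [folklore]: probability spaces `μ K`, observables `|X K i| ≤ B` (a.e.-measurable) all
of whose MIXED MOMENTS converge; then `∫ f(X K) dμ_K` converges for EVERY continuous `f : (ι → ℝ) → ℝ` — multivariate Weierstrass on the cube
`[−B,B]^ι` (Mathlib's Stone–Weierstrass on the coordinate subalgebra) and the Cauchy criterion. -/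
theorem tendsto_integral_comp_of_tendsto_mixedMoments [∀ K, IsProbabilityMeasure (μ K)] [Fintype ι] [DecidableEq ι]
    (hX : ∀ K i, AEMeasurable (X K i) (μ K)) (hB : ∀ K i ω, |X K i ω| ≤ B)
    (hmom : ∀ k : ι → ℕ, ∃ a : ℝ, Tendsto (fun K => ∫ ω, ∏ i, X K i ω ^ k i ∂μ K) atTop (𝓝 a))
    {f : (ι → ℝ) → ℝ} (hf : Continuous f) :
    ∃ a : ℝ, Tendsto (fun K => ∫ ω, f (fun i => X K i ω) ∂μ K) atTop (𝓝 a) := by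
  refine cauchySeq_tendsto_of_complete (Metric.cauchySeq_iff'.2 fun ε hε => ?_)
  obtain ⟨g, hgA, hg⟩ := ContinuousMap.exists_mem_subalgebra_near_continuous_of_isCompact_of_separatesPoints
    (coordSubalgebra_separatesPoints (ι := ι)) ⟨f, hf⟩
    (isCompact_univ_pi fun _ : ι => (isCompact_Icc : IsCompact (Icc (-B) B))) (ε := ε / 3) (by positivity)
  obtain ⟨p, rfl⟩ := (AlgHom.mem_range _).1 hgA
  obtain ⟨a, ha⟩ := tendsto_integral_mvPolynomial_of_tendsto_mixedMoments hX hB hmom p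
  obtain ⟨N, hN⟩ := Metric.cauchySeq_iff'.1 ha.cauchySeq (ε / 3) (by positivity)
  have hclose : ∀ K, dist (∫ ω, f (fun i => X K i ω) ∂μ K) (∫ ω, MvPolynomial.eval (fun i => X K i ω) p ∂μ K) ≤ ε / 3 := fun K => by
    rw [dist_eq_norm, ← integral_sub (integrable_comp_vec hX hB hf K)
      (integrable_comp_vec hX hB (MvPolynomial.continuous_eval p) K)]
    refine (norm_integral_le_of_norm_le_const (C := ε / 3) (Eventually.of_forall fun ω => ?_)).trans
      (by rw [probReal_univ, mul_one])
    have h := hg _ (vec_mem_cube hB K ω)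
    rw [aeval_coord_apply] at h
    rw [Real.norm_eq_abs, abs_sub_comm]
    exact (le_of_lt (by simpa [Real.norm_eq_abs] using h))
  refine ⟨N, fun K hK => ?_⟩
  calc dist (∫ ω, f (fun i => X K i ω) ∂μ K) (∫ ω, f (fun i => X N i ω) ∂μ N)
      ≤ dist (∫ ω, f (fun i => X K i ω) ∂μ K) (∫ ω, MvPolynomial.eval (fun i => X K i ω) p ∂μ K)
          + dist (∫ ω, MvPolynomial.eval (fun i => X K i ω) p ∂μ K) (∫ ω, MvPolynomial.eval (fun i => X N i ω) p ∂μ N)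
          + dist (∫ ω, MvPolynomial.eval (fun i => X N i ω) p ∂μ N) (∫ ω, f (fun i => X N i ω) ∂μ N) := dist_triangle4 _ _ _ _
    _ < ε / 3 + ε / 3 + ε / 3 := by
        have h₁ := hclose K
        have h₂ := hN K hK
        have h₃ := hclose N
        rw [dist_comm] at h₃
        linarith
    _ = ε := by ring

/-- ★★ **THE CONTINUUM JOINT LAW** [folklore] (determinacy on a compact cube, via Riesz–Markov–Kakutani): probability spaces `μ K`, a vector of
observables `|X K i| ≤ B` (`0 ≤ B`, a.e.-measurable) ALL OF WHOSE MIXED MOMENTS CONVERGE; then there is a probability measure `ν` on `ι → ℝ`, carried by the cube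
`[−B,B]^ι`, with `∫ f(X K) dμ_K → ∫ f dν` for EVERY continuous `f : (ι → ℝ) → ℝ`.  Construction: the limit functional on `C([−B,B]^ι, ℝ)` (previous
theorem, through the coordinatewise retraction `projIcc`) is linear, positive, normalised; `RealRMK.rieszMeasure` on the compact cube, pushed to `ι → ℝ`. -/
theorem exists_jointLawLimit_of_tendsto_mixedMoments [∀ K, IsProbabilityMeasure (μ K)] [Fintype ι] [DecidableEq ι]
    (hX : ∀ K i, AEMeasurable (X K i) (μ K)) (h0 : 0 ≤ B) (hB : ∀ K i ω, |X K i ω| ≤ B)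
    (hmom : ∀ k : ι → ℕ, ∃ a : ℝ, Tendsto (fun K => ∫ ω, ∏ i, X K i ω ^ k i ∂μ K) atTop (𝓝 a)) :
    ∃ ν : Measure (ι → ℝ), IsProbabilityMeasure ν ∧ ν (Set.pi Set.univ (fun _ : ι => Icc (-B) B))ᶜ = 0 ∧
      ∀ f : (ι → ℝ) → ℝ, Continuous f → Tendsto (fun K => ∫ ω, f (fun i => X K i ω) ∂μ K) atTop (𝓝 (∫ x, f x ∂ν)) := by
  have h0' : -B ≤ B := by linarith
  -- the compact cube as a product of compact intervals, its embedding and the coordinatewise retraction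
  let Q : Type _ := ι → Icc (-B) B
  let emb : Q → (ι → ℝ) := fun y i => (y i : ℝ)
  have hemb : Continuous emb := continuous_pi fun i => continuous_subtype_val.comp (continuous_apply i)
  have hembm : Measurable emb := hemb.measurable
  let ρ : (ι → ℝ) → Q := fun x i => projIcc (-B) B h0' (x i)
  have hρ : Continuous ρ := continuous_pi fun i => continuous_projIcc.comp (continuous_apply i)
  have hρX : ∀ K ω, emb (ρ (fun i => X K i ω)) = fun i => X K i ω := fun K ω => by
    ext i
    simp only [emb, ρ, projIcc_of_mem h0' (abs_le.1 (hB K i ω))]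
  -- the limit functional on `C(Q, ℝ)`
  have hL : ∀ φ : C(Q, ℝ), ∃ a : ℝ, Tendsto (fun K => ∫ ω, φ (ρ (fun i => X K i ω)) ∂μ K) atTop (𝓝 a) :=
    fun φ => tendsto_integral_comp_of_tendsto_mixedMoments hX hB hmom (f := fun x => φ (ρ x)) (φ.continuous.comp hρ)
  choose L hL using hL
  have hI : ∀ (K) (φ : C(Q, ℝ)), Integrable (fun ω => φ (ρ (fun i => X K i ω))) (μ K) := fun K φ =>
    integrable_comp_vec hX hB (f := fun x => φ (ρ x)) (φ.continuous.comp hρ) K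
  have hadd : ∀ φ ψ : C(Q, ℝ), L (φ + ψ) = L φ + L ψ := fun φ ψ =>
    tendsto_nhds_unique (hL (φ + ψ)) (((hL φ).add (hL ψ)).congr fun K => by
      simp only [ContinuousMap.add_apply]
      exact (integral_add (hI K φ) (hI K ψ)).symm)
  have hsmul : ∀ (c : ℝ) (φ : C(Q, ℝ)), L (c • φ) = c * L φ := fun c φ =>
    tendsto_nhds_unique (hL (c • φ)) (((hL φ).const_mul c).congr fun K => by
      simp only [ContinuousMap.smul_apply, smul_eq_mul]
      exact (integral_const_mul c _).symm)
  have hpos : ∀ φ : C(Q, ℝ), (∀ y, 0 ≤ φ y) → 0 ≤ L φ := fun φ hφ =>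
    ge_of_tendsto' (hL φ) fun K => integral_nonneg fun ω => hφ _
  have hone : L 1 = 1 := tendsto_nhds_unique (hL 1) (tendsto_const_nhds.congr fun K => by simp)
  -- Riesz–Markov–Kakutani on the compact cube
  let Λₗ : C_c(Q, ℝ) →ₗ[ℝ] ℝ :=
    { toFun := fun f => L f.toContinuousMap
      map_add' := fun f g => by
        have : (f + g).toContinuousMap = f.toContinuousMap + g.toContinuousMap := by ext; rfl
        rw [this, hadd]
      map_smul' := fun c f => by
        have : (c • f).toContinuousMap = c • f.toContinuousMap := by ext; rfl
        rw [this, hsmul]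
        rfl }
  let Λp : C_c(Q, ℝ) →ₚ[ℝ] ℝ := PositiveLinearMap.mk₀ Λₗ fun f hf => hpos f.toContinuousMap fun y => hf y
  have hΛp : ∀ f, Λp f = L f.toContinuousMap := fun _ => rfl
  let ν₀ : Measure Q := RealRMK.rieszMeasure Λp
  have hν₀ : ∀ φ : C(Q, ℝ), ∫ y, φ y ∂ν₀ = L φ := fun φ => by
    have h := RealRMK.integral_rieszMeasure Λp ⟨φ, HasCompactSupport.of_compactSpace φ⟩
    rw [hΛp] at h
    exact h
  haveI : IsProbabilityMeasure ν₀ := by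
    constructor
    have h1 : ∫ y, (1 : C(Q, ℝ)) y ∂ν₀ = 1 := (hν₀ 1).trans hone
    simp only [ContinuousMap.one_apply, integral_const, smul_eq_mul, mul_one] at h1
    rwa [measureReal_def, ENNReal.toReal_eq_one_iff] at h1
  -- push forward to `ι → ℝ`
  have hpre : emb ⁻¹' (Set.pi Set.univ (fun _ : ι => Icc (-B) B))ᶜ = ∅ := by
    ext y
    simp only [mem_preimage, mem_compl_iff, mem_empty_iff_false, iff_false, not_not, Set.mem_univ_pi]
    exact fun i => (y i).2
  refine ⟨ν₀.map emb, Measure.isProbabilityMeasure_map hembm.aemeasurable, ?_, fun f hf => ?_⟩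
  · rw [Measure.map_apply hembm (MeasurableSet.univ_pi fun _ => measurableSet_Icc).compl, hpre, measure_empty]
  · rw [integral_map hembm.aemeasurable hf.aestronglyMeasurable]
    have h := hL ⟨fun y => f (emb y), hf.comp hemb⟩
    rw [← hν₀] at h
    refine h.congr fun K => integral_congr_ae (Eventually.of_forall fun ω => ?_)
    simp only [ContinuousMap.coe_mk, hρX K ω]

/-- **THE CONTINUUM JOINT LAW IS UNIQUE**: two probability measures on `ι → ℝ` receiving the limits of all continuous observables coincide (Mathlib
`ext_of_forall_integral_eq_of_IsFiniteMeasure`). [folklore] -/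
theorem jointLawLimit_unique [Fintype ι] (ν₁ ν₂ : Measure (ι → ℝ)) [IsProbabilityMeasure ν₁] [IsProbabilityMeasure ν₂]
    (h₁ : ∀ f : (ι → ℝ) → ℝ, Continuous f → Tendsto (fun K => ∫ ω, f (fun i => X K i ω) ∂μ K) atTop (𝓝 (∫ x, f x ∂ν₁)))
    (h₂ : ∀ f : (ι → ℝ) → ℝ, Continuous f → Tendsto (fun K => ∫ ω, f (fun i => X K i ω) ∂μ K) atTop (𝓝 (∫ x, f x ∂ν₂))) :
    ν₁ = ν₂ :=
  ext_of_forall_integral_eq_of_IsFiniteMeasure fun f => tendsto_nhds_unique (h₁ f f.continuous) (h₂ f f.continuous)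

/-- **WEAK CONVERGENCE OF THE JOINT LAWS** in Mathlib's words: the laws `(μ K).map (X K)` converge to `ν` in `ProbabilityMeasure (ι → ℝ)`. [folklore] -/
theorem tendsto_jointLaw_of_jointLawLimit [∀ K, IsProbabilityMeasure (μ K)] [Fintype ι]
    (hX : ∀ K i, AEMeasurable (X K i) (μ K)) (ν : ProbabilityMeasure (ι → ℝ))
    (hν : ∀ f : (ι → ℝ) → ℝ, Continuous f →
      Tendsto (fun K => ∫ ω, f (fun i => X K i ω) ∂μ K) atTop (𝓝 (∫ x, f x ∂(ν : Measure (ι → ℝ))))) :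
    Tendsto (β := ProbabilityMeasure (ι → ℝ))
      (fun K => ⟨(μ K).map (fun ω => fun i => X K i ω), Measure.isProbabilityMeasure_map (aemeasurable_vec hX K)⟩) atTop (𝓝 ν) := by
  refine ProbabilityMeasure.tendsto_iff_forall_integral_tendsto.2 fun f => ?_
  exact (hν f f.continuous).congr fun K => (integral_map (aemeasurable_vec hX K) f.continuous.aestronglyMeasurable).symm

end Generic

/-! ## §2 At the scheme: `HasContinuumLimit` ⇒ the continuum joint laws of every finite family of strings -/

section Scheme

open T4GenFunBounds (prodObs gibbsMeasure expectAt_eq_integral_gibbs)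
open Missing (TorusScheme HasContinuumLimit)

variable {G : Type*} [GaugeGroup G] [MeasurableSpace G] [RegularGaugeGroup G] [HaarData G] {O : Type*}
  (S : TorusScheme G O) (hβ : ∀ K, 0 ≤ S.β K) (hm : ∀ K o, Measurable (S.obs K o))
  (h1 : ∀ K o U, |S.obs K o U| ≤ 1)

omit [GaugeGroup G] [MeasurableSpace G] [RegularGaugeGroup G] [HaarData G] in
/-- The string observable is multiplicative under concatenation. [bookkeeping] -/
theorem prodObs_append (K : ℕ) (os os' : List O) (U : GaugeField (S.P K) 0 G) :
    prodObs S K (os ++ os') U = prodObs S K os U * prodObs S K os' U := by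
  simp [prodObs, List.map_append, List.prod_append]

omit [GaugeGroup G] [MeasurableSpace G] [RegularGaugeGroup G] [HaarData G] in
/-- … over a list of strings. [bookkeeping] -/
theorem prodObs_flatten (K : ℕ) (L : List (List O)) (U : GaugeField (S.P K) 0 G) :
    prodObs S K L.flatten U = (L.map fun os => prodObs S K os U).prod := by
  induction L with
  | nil => simp [prodObs]
  | cons os L ih => rw [List.flatten_cons, prodObs_append, ih, List.map_cons, List.prod_cons]

omit [GaugeGroup G] [MeasurableSpace G] [RegularGaugeGroup G] [HaarData G] in
/-- … powers are repeated strings. [bookkeeping] -/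
theorem prodObs_replicate_flatten (K : ℕ) (os : List O) (n : ℕ) (U : GaugeField (S.P K) 0 G) :
    prodObs S K (List.replicate n os).flatten U = prodObs S K os U ^ n := by
  rw [prodObs_flatten, List.map_replicate, List.prod_replicate]

omit [GaugeGroup G] [MeasurableSpace G] [RegularGaugeGroup G] [HaarData G] in
/-- **A MIXED MONOMIAL OF STRING OBSERVABLES IS A STRING OBSERVABLE**: for strings `os_i` and exponents `k_i`,
`∏_i (∏os_i)^{k_i} = ∏(the concatenation of `k_i` copies of each `os_i`)`. [bookkeeping] -/
theorem prodObs_mixedString {ι : Type*} [Fintype ι] (K : ℕ) (os : ι → List O) (k : ι → ℕ) (U : GaugeField (S.P K) 0 G) :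
    prodObs S K ((Finset.univ.toList.map fun i => (List.replicate (k i) (os i)).flatten).flatten) U =
      ∏ i, prodObs S K (os i) U ^ k i := by
  rw [prodObs_flatten, List.map_map, ← Finset.prod_map_toList]
  congr 1
  refine List.map_congr_left fun i _ => ?_
  simp only [Function.comp_apply, prodObs_replicate_flatten]

include hβ hm h1

omit hm h1 in
/-- **★ MIXED MOMENTS CONVERGE UNDER `HasContinuumLimit`**: for every finite family of strings `os_i` and exponents `k_i`,
`∫ ∏_i (∏os_i)^{k_i} dgibbs_K` converges (it is `S.expectAt K` of the concatenated string). [bookkeeping] -/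
theorem tendsto_mixedMoment_of_hasContinuumLimit (hC : HasContinuumLimit S) {ι : Type*} [Fintype ι] (os : ι → List O) (k : ι → ℕ) :
    ∃ a : ℝ, Tendsto (fun K => ∫ U, ∏ i, prodObs S K (os i) U ^ k i ∂gibbsMeasure (S.P K) (S.β K)) atTop (𝓝 a) := by
  obtain ⟨l, hl⟩ := hC ((Finset.univ.toList.map fun i => (List.replicate (k i) (os i)).flatten).flatten)
  refine ⟨l, hl.congr fun K => ?_⟩
  rw [expectAt_eq_integral_gibbs S hβ K]
  exact integral_congr_ae (ae_of_all _ fun U => prodObs_mixedString S K os k U)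

/-- **★★ THE CONTINUUM JOINT LAWS FROM `HasContinuumLimit`.**  For a torus scheme with `β_K ≥ 0` and measurable observables bounded by `1`, IF all string
expectations converge (`Missing.HasContinuumLimit S` — a HYPOTHESIS; Jaffe–Witten's «limits of appropriate expectations» as the tree types it), THEN for
every finite family of strings `(os_i)_{i∈ι}` there is a unique probability law `ν` on `ι → ℝ`, carried by the cube `[−1,1]^ι`, with
`∫ f((∏os_i)_i) dgibbs_K → ∫ f dν` for EVERY continuous `f : (ι → ℝ) → ℝ`: the joint law of the string observables converges weakly to `ν` — the
continuum finite-dimensional distribution of the string field indexed by `(os_i)_i`.  (§1 on the vector observable `(∏os_i)_i`: mixed moments are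
expectations of concatenated strings.) [folklore] -/
theorem exists_jointContinuumLaw_of_hasContinuumLimit (hC : HasContinuumLimit S) {ι : Type*} [Fintype ι] [DecidableEq ι] (os : ι → List O) :
    ∃ ν : Measure (ι → ℝ), IsProbabilityMeasure ν ∧ ν (Set.pi Set.univ (fun _ : ι => Icc (-1) 1))ᶜ = 0 ∧
      (∀ f : (ι → ℝ) → ℝ, Continuous f →
        Tendsto (fun K => ∫ U, f (fun i => prodObs S K (os i) U) ∂gibbsMeasure (S.P K) (S.β K)) atTop (𝓝 (∫ x, f x ∂ν))) ∧
      ∀ ν' : Measure (ι → ℝ), IsProbabilityMeasure ν' →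
        (∀ f : (ι → ℝ) → ℝ, Continuous f →
          Tendsto (fun K => ∫ U, f (fun i => prodObs S K (os i) U) ∂gibbsMeasure (S.P K) (S.β K)) atTop (𝓝 (∫ x, f x ∂ν'))) → ν' = ν := by
  haveI hP : ∀ K, IsProbabilityMeasure (gibbsMeasure (G := G) (S.P K) (S.β K)) := fun K =>
    T4GenFunBounds.isProbabilityMeasure_gibbsMeasure (G := G) (S.P K) (hβ K)
  have hX : ∀ K i, AEMeasurable (fun U => prodObs S K (os i) U) (gibbsMeasure (S.P K) (S.β K)) := fun K i =>
    (T4GenFunBounds.measurable_prodObs S hm K (os i)).aemeasurable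
  have hB : ∀ K i U, |prodObs S K (os i) U| ≤ 1 := fun K i U => T4GenFunBounds.abs_prodObs_le_one S h1 K (os i) U
  obtain ⟨ν, iν, hν1, hν⟩ := exists_jointLawLimit_of_tendsto_mixedMoments (μ := fun K => gibbsMeasure (S.P K) (S.β K))
    (X := fun K i U => prodObs S K (os i) U) hX zero_le_one hB (fun k => tendsto_mixedMoment_of_hasContinuumLimit S hβ hC os k)
  exact ⟨ν, iν, hν1, hν, fun ν' iν' hν' => jointLawLimit_unique (μ := fun K => gibbsMeasure (S.P K) (S.β K))
    (X := fun K i U => prodObs S K (os i) U) ν' ν hν' hν⟩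

/-- **★ … UNDER NODE U5's PER-STRING OUTPUT** (`T4ApexVariance.StringwiseMatching S` ⇒ `HasContinuumLimit S` by the tree's
`T4ApexVariance.hasContinuumLimit_of_stringwiseMatching`): per-string matching modulo constants with summable remainders already carries the continuum
joint laws of every finite family of strings. [folklore] -/
theorem exists_jointContinuumLaw_of_stringwiseMatching (h : T4ApexVariance.StringwiseMatching S) {ι : Type*} [Fintype ι] [DecidableEq ι]
    (os : ι → List O) :
    ∃ ν : Measure (ι → ℝ), IsProbabilityMeasure ν ∧ ν (Set.pi Set.univ (fun _ : ι => Icc (-1) 1))ᶜ = 0 ∧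
      ∀ f : (ι → ℝ) → ℝ, Continuous f →
        Tendsto (fun K => ∫ U, f (fun i => prodObs S K (os i) U) ∂gibbsMeasure (S.P K) (S.β K)) atTop (𝓝 (∫ x, f x ∂ν)) := by
  obtain ⟨ν, iν, hν1, hν, -⟩ := exists_jointContinuumLaw_of_hasContinuumLimit S hβ hm h1
    (T4ApexVariance.hasContinuumLimit_of_stringwiseMatching S hβ hm h1 h) os
  exact ⟨ν, iν, hν1, hν⟩

end Scheme

end Summit.QuantumFields.YangMills.Theorems.BalabanUVNodesN19ContinuumJointLaws

end
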